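import Mathlib
import Summits.MatrixMultiplication.MatrixMultiplication.Theorems.PrimeTwoFamilies.Negative.Slices
import Summits.MatrixMultiplication.MatrixMultiplication.Theorems.FourierTwoFamiliesModPCyclicReductionTransfer
import Summits.MatrixMultiplication.MatrixMultiplication.Theorems.FourierTwoFamiliesModPPrimeTwoFamiliesCapacityLift

/-!
# Capacity gadgets give every slice of `PrimeTwoFamilies` — letterwise bookkeeping (support file)

Item `stmt-MatrixMultiplication-14308` (`FourierTwoFamiliesModP.PrimeTwoFamilies`, CKSU 2005 Conj. 4.7 with
prime cyclic hosts), line `Sketch` (capacity-gadget skeleton `Cruxes/PrimeTwoFamilies/Lines/Sketch.lean`),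
registered stub `primeTwoFamiliesAt_of_capacityGadgets`, siege attempt k21 ("Mathlib API route").

The statement: if for every `ε > 0` there are arbitrarily large `m`, direct pairs `(P c, Q c)_{c<r}` in
`ZMod m` of co-volume `m^{1-ε} ≤ |P c| |Q c|` and a zero-error code `W` of words `Fin L → Fin r`
(`1 ≤ L`, every ordered pair of distinct words strongly separated in some coordinate) with
`(m^L)^{1/2-ε} ≤ |W|`, then every slice `PrimeTwoFamiliesAt δ`, `0 < δ ≤ 1`, holds.

This file is an independent writing of the transfer whose real-exponent bookkeeping is LETTERWISE
(`letterwise_bookkeeping`): with `a := 1/(2+δ)` and the single-letter quantity `T := 2·6^a·m^a`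
one keeps `n := max n₀ ⌈((6m)^L)^a⌉₊ ≤ T^L` pairs, and the two one-letter inequalities
`T ≤ m^{1/2-δ/16}`, `T^{2-δ} ≤ m^{1-δ/16}` (true for `m ≥ m₀(δ, n₀)`, thresholds obtained from Mathlib's
`tendsto_rpow_atTop`) are simply raised to the `L`-th power — uniformity in the word length `L` is then
automatic.  The combinatorics is the tree's API: the code lift `CapacityLift.codeLift` and the carry-free
transfer into a Bertrand prime `Theorems.exists_prime_sdpp_of_addEquiv` (`p ≤ 2·3^L·m^L ≤ (6m)^L ≤ n^{2+δ}`);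
the family is truncated to `n` words BEFORE lifting, so no re-indexing after the transfer is needed.

Other proofs of the same statement in the tree: `CapacityLift.primeTwoFamiliesAt_of_capacityGadgets`
(exponent `θ`-bookkeeping `stub_capBookkeeping`) and `CapacityLift.stub_capacityTransfer`.
-/

-- single-conjunct summit: the mandated namespace repeats `MatrixMultiplication` (summit = sub-problem).
set_option linter.dupNamespace false

namespace Summit.MatrixMultiplication.MatrixMultiplication.Theorems.PrimeTwoFamilies.CapacityLiftK21

open Finset Filter
open Summit.MatrixMultiplication.MatrixMultiplication.Theorems
open Summit.MatrixMultiplication.MatrixMultiplication.Theorems.PrimeTwoFamilies.Negative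
open Summit.MatrixMultiplication.MatrixMultiplication.Theorems.PrimeTwoFamilies.CapacityLift (codeLift)

/-- Thresholds from Mathlib's asymptotics API: a constant is eventually below any positive real power
of a natural number, `∀ᶠ m in atTop, K ≤ m ^ g` (`0 < g`). -/
private theorem eventually_le_rpow (K g : ℝ) (hg : 0 < g) :
    ∀ᶠ m : ℕ in atTop, K ≤ (m : ℝ) ^ g :=
  ((tendsto_rpow_atTop hg).comp tendsto_natCast_atTop_atTop).eventually_ge_atTop K

/-- **Letterwise bookkeeping.**  For `0 < δ ≤ 1` and every `n₀` there is a threshold `m₀` (depending on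
`δ, n₀` only) such that for every `m ≥ m₀` and every word length `L ≥ 1` some number `n ≥ n₀` of pairs
satisfies `n ≤ (m^{1/2-δ/16})^L`, `2·3^L·m^L ≤ n^{2+δ}` and `n^{2-δ} ≤ (m^{1-δ/16})^L`.
Choice: `n := max n₀ ⌈((6m)^L)^{1/(2+δ)}⌉₊ ≤ T^L` with the one-letter quantity
`T := 2·6^{1/(2+δ)}·m^{1/(2+δ)}`, and `T ≤ m^{1/2-δ/16}`, `T^{2-δ} ≤ m^{1-δ/16}` for large `m` by the
exponent gaps `1/(2+δ) < 1/2 - δ/16` and `(2-δ)/(2+δ) < 1 - δ/16`. -/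
private theorem letterwise_bookkeeping {δ : ℝ} (hδ : 0 < δ) (hδ1 : δ ≤ 1) (n₀ : ℕ) :
    ∃ m₀ : ℕ, ∀ m : ℕ, m₀ ≤ m → ∀ L : ℕ, 1 ≤ L →
      ∃ n : ℕ, n₀ ≤ n ∧ (n : ℝ) ≤ ((m : ℝ) ^ (1 / 2 - δ / 16)) ^ L ∧
        2 * (3 ^ L * (m : ℝ) ^ L) ≤ (n : ℝ) ^ (2 + δ) ∧
        (n : ℝ) ^ (2 - δ) ≤ ((m : ℝ) ^ (1 - δ / 16)) ^ L := by
  have h2δ : (0 : ℝ) < 2 + δ := by positivity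
  -- the root exponent `a = 1/(2+δ)` and the one-letter constant `c = 2·6^a`
  obtain ⟨a, ha⟩ : ∃ a : ℝ, a = (2 + δ)⁻¹ := ⟨_, rfl⟩
  have ha0 : 0 < a := ha ▸ inv_pos.2 h2δ
  have hg₁ : 0 < 1 / 2 - δ / 16 - a := by
    rw [ha, sub_pos, inv_eq_one_div, div_lt_iff₀ h2δ]
    nlinarith [mul_pos hδ (show (0 : ℝ) < 6 - δ by linarith)]
  have hg₂ : 0 < 1 - δ / 16 - (2 - δ) * a := by
    rw [ha, sub_pos, ← div_eq_mul_inv, div_lt_iff₀ h2δ]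
    nlinarith [mul_pos hδ (show (0 : ℝ) < 30 - δ by linarith)]
  obtain ⟨c, hc⟩ : ∃ c : ℝ, c = 2 * (6 : ℝ) ^ a := ⟨_, rfl⟩
  have h6a : (1 : ℝ) ≤ (6 : ℝ) ^ a := Real.one_le_rpow (by norm_num) ha0.le
  have hc2 : 2 ≤ c := by rw [hc]; linarith
  have hc0 : 0 ≤ c := zero_le_two.trans hc2
  -- thresholds, uniform in `L`
  obtain ⟨m₀, hm₀⟩ := eventually_atTop.1 <|
    (eventually_le_rpow c _ hg₁).and <| (eventually_le_rpow (c ^ (2 - δ)) _ hg₂).and <|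
      (eventually_le_rpow n₀ a ha0).and (eventually_ge_atTop 1)
  refine ⟨m₀, fun m hm L hL => ?_⟩
  obtain ⟨h₁, h₂, h₃, hm1⟩ := hm₀ m hm
  have hL0 : L ≠ 0 := by omega
  have hm1R : (1 : ℝ) ≤ m := by exact_mod_cast hm1
  have hm0R : (0 : ℝ) ≤ m := zero_le_one.trans hm1R
  have hmpos : (0 : ℝ) < m := one_pos.trans_le hm1R
  have hma0 : (0 : ℝ) ≤ (m : ℝ) ^ a := Real.rpow_nonneg hm0R _
  have hma1 : (1 : ℝ) ≤ (m : ℝ) ^ a := Real.one_le_rpow hm1R ha0.le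
  -- the one-letter quantity `T = c·m^a` and its two inequalities
  obtain ⟨T, hT⟩ : ∃ T : ℝ, T = c * (m : ℝ) ^ a := ⟨_, rfl⟩
  have hT1 : 1 ≤ T := by rw [hT]; nlinarith
  have hT0 : 0 ≤ T := zero_le_one.trans hT1
  have hTle : T ≤ (m : ℝ) ^ (1 / 2 - δ / 16) := by
    calc T = c * (m : ℝ) ^ a := hT
      _ ≤ (m : ℝ) ^ (1 / 2 - δ / 16 - a) * (m : ℝ) ^ a := mul_le_mul_of_nonneg_right h₁ hma0
      _ = (m : ℝ) ^ (1 / 2 - δ / 16) := by rw [← Real.rpow_add hmpos, sub_add_cancel]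
  have hTpow : T ^ (2 - δ) ≤ (m : ℝ) ^ (1 - δ / 16) := by
    calc T ^ (2 - δ) = c ^ (2 - δ) * (m : ℝ) ^ ((2 - δ) * a) := by
          rw [hT, Real.mul_rpow hc0 hma0, ← Real.rpow_mul hm0R, mul_comm a]
      _ ≤ (m : ℝ) ^ (1 - δ / 16 - (2 - δ) * a) * (m : ℝ) ^ ((2 - δ) * a) :=
          mul_le_mul_of_nonneg_right h₂ (Real.rpow_nonneg hm0R _)
      _ = (m : ℝ) ^ (1 - δ / 16) := by rw [← Real.rpow_add hmpos, sub_add_cancel]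
  -- the host size `X = (6m)^L` and the number of pairs `n = max n₀ ⌈X^a⌉₊ ≤ T^L`
  obtain ⟨X, hX⟩ : ∃ X : ℝ, X = (6 * (m : ℝ)) ^ L := ⟨_, rfl⟩
  have h6m : (0 : ℝ) ≤ 6 * (m : ℝ) := by positivity
  have hX0 : 0 ≤ X := hX ▸ pow_nonneg h6m L
  have hXa0 : 0 ≤ X ^ a := Real.rpow_nonneg hX0 _
  have hXa : X ^ a = ((6 : ℝ) ^ a * (m : ℝ) ^ a) ^ L := by
    rw [hX, ← Real.rpow_pow_comm h6m, Real.mul_rpow (by norm_num) hm0R]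
  have h2L : (2 : ℝ) ≤ 2 ^ L := by
    calc (2 : ℝ) = 2 ^ 1 := (pow_one _).symm
      _ ≤ 2 ^ L := pow_le_pow_right₀ one_le_two hL
  have h6amL : (1 : ℝ) ≤ ((6 : ℝ) ^ a * (m : ℝ) ^ a) ^ L :=
    one_le_pow₀ (one_le_mul_of_one_le_of_one_le h6a hma1)
  have hXa1 : 1 ≤ X ^ a := by rw [hXa]; exact h6amL
  have hceil : ((⌈X ^ a⌉₊ : ℕ) : ℝ) ≤ T ^ L := by
    have hlt : ((⌈X ^ a⌉₊ : ℕ) : ℝ) < X ^ a + 1 := Nat.ceil_lt_add_one hXa0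
    calc ((⌈X ^ a⌉₊ : ℕ) : ℝ) ≤ 2 * X ^ a := by linarith
      _ = 2 * ((6 : ℝ) ^ a * (m : ℝ) ^ a) ^ L := by rw [hXa]
      _ ≤ 2 ^ L * ((6 : ℝ) ^ a * (m : ℝ) ^ a) ^ L :=
          mul_le_mul_of_nonneg_right h2L (zero_le_one.trans h6amL)
      _ = T ^ L := by rw [← mul_pow, hT, hc, mul_assoc]
  have hn₀T : (n₀ : ℝ) ≤ T ^ L := by
    calc (n₀ : ℝ) ≤ (m : ℝ) ^ a := h₃
      _ ≤ c * (m : ℝ) ^ a := le_mul_of_one_le_left hma0 (one_le_two.trans hc2)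
      _ = T := hT.symm
      _ ≤ T ^ L := le_self_pow₀ hT1 hL0
  have hnT : ((max n₀ ⌈X ^ a⌉₊ : ℕ) : ℝ) ≤ T ^ L := by
    rw [Nat.cast_max]
    exact max_le hn₀T hceil
  refine ⟨max n₀ ⌈X ^ a⌉₊, le_max_left _ _, hnT.trans (pow_le_pow_left₀ hT0 hTle L), ?_, ?_⟩
  · -- `2·3^L·m^L ≤ (6m)^L = (X^a)^(2+δ) ≤ n^(2+δ)`
    have hXn : X ^ a ≤ ((max n₀ ⌈X ^ a⌉₊ : ℕ) : ℝ) :=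
      (Nat.le_ceil _).trans (by exact_mod_cast le_max_right _ _)
    calc 2 * (3 ^ L * (m : ℝ) ^ L) ≤ 2 ^ L * (3 ^ L * (m : ℝ) ^ L) :=
          mul_le_mul_of_nonneg_right h2L (by positivity)
      _ = X := by rw [hX, mul_pow, ← mul_assoc, ← mul_pow]; norm_num
      _ = (X ^ a) ^ (2 + δ) := by rw [ha, Real.rpow_inv_rpow hX0 h2δ.ne']
      _ ≤ ((max n₀ ⌈X ^ a⌉₊ : ℕ) : ℝ) ^ (2 + δ) := Real.rpow_le_rpow hXa0 hXn h2δ.le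
  · -- `n^(2-δ) ≤ (T^L)^(2-δ) = (T^(2-δ))^L ≤ (m^(1-δ/16))^L`
    calc ((max n₀ ⌈X ^ a⌉₊ : ℕ) : ℝ) ^ (2 - δ) ≤ (T ^ L) ^ (2 - δ) :=
          Real.rpow_le_rpow (Nat.cast_nonneg _) hnT (by linarith)
      _ = (T ^ (2 - δ)) ^ L := (Real.rpow_pow_comm hT0 _ _).symm
      _ ≤ ((m : ℝ) ^ (1 - δ / 16)) ^ L := pow_le_pow_left₀ (Real.rpow_nonneg hT0 _) hTpow L

/-- **Capacity gadgets give the crux, slice by slice** (registered stub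
`primeTwoFamiliesAt_of_capacityGadgets` of line `Sketch`, crux stmt-MatrixMultiplication-14308).  If for
every `ε > 0` there are arbitrarily large `m`, direct pairs `(P c, Q c)_{c<r}` in `ZMod m` of co-volume
`m^{1-ε} ≤ |P c||Q c|` and a zero-error code `W` of words `Fin L → Fin r` (`1 ≤ L`, every ordered pair of
distinct words strongly separated in some coordinate) with `(m^L)^{1/2-ε} ≤ |W|`, then every slice
`0 < δ ≤ 1` of `PrimeTwoFamilies` holds: arbitrarily large `n`, a prime `p ≤ n^{2+δ}` and `n` SDPP pairs
in `ZMod p` of co-volume `≥ n^{2-δ}`.  Proof: `ε := δ/16`; a gadget level `m ≥ m₀` from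
`letterwise_bookkeeping` gives `n` with `n ≤ (m^{1/2-ε})^L ≤ |W|`; pick `n` words of `W`
(`Finset.equivFin`, `Fin.castLE`), lift them to `n` SDPP product blocks in `Fin L → ZMod m`
(`CapacityLift.codeLift`), move these into a prime `p ≤ 2·3^L·m^L ≤ n^{2+δ}` with block sizes kept
(`Theorems.exists_prime_sdpp_of_addEquiv`, `L` factors `ZMod m`), and bound each co-volume
`∏ₜ |P (w t)||Q (w t)| ≥ (m^{1-ε})^L ≥ n^{2-δ}`. -/
theorem primeTwoFamiliesAt_of_capacityGadgets
    (hC : ∀ ε : ℝ, 0 < ε → ∀ m₀ : ℕ, ∃ m ≥ m₀, ∃ r L : ℕ, ∃ P Q : Fin r → Finset (ZMod m),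
      ∃ W : Finset (Fin L → Fin r),
      (∀ c : Fin r, ∀ x ∈ P c, ∀ x' ∈ P c, ∀ y ∈ Q c, ∀ y' ∈ Q c,
          (x - x') + (y - y') = 0 → x = x' ∧ y = y') ∧
      (∀ i ∈ W, ∀ k ∈ W, i ≠ k → ∃ t : Fin L,
        ∀ p ∈ P (i t), ∀ q ∈ Q (k t), ∀ c : Fin r, ∀ p' ∈ P c, ∀ q' ∈ Q c, q - p ≠ q' - p') ∧
      1 ≤ L ∧
      ((m : ℝ) ^ (L : ℝ)) ^ (1 / 2 - ε) ≤ (W.card : ℝ) ∧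
      ∀ c : Fin r, (m : ℝ) ^ (1 - ε) ≤ (((P c).card * (Q c).card : ℕ) : ℝ))
    {δ : ℝ} (hδ : 0 < δ) (hδ1 : δ ≤ 1) : PrimeTwoFamiliesAt δ := by
  classical
  intro n₀
  obtain ⟨m₀, hm₀⟩ := letterwise_bookkeeping hδ hδ1 n₀
  obtain ⟨m, hm, r, L, P, Q, W, hD, hS, hL, hWcard, hcov⟩ := hC (δ / 16) (by positivity) (max m₀ 1)
  have hm1 : 0 < m := lt_of_lt_of_le one_pos (le_trans (le_max_right _ _) hm)
  have hm0R : (0 : ℝ) ≤ m := Nat.cast_nonneg _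
  obtain ⟨n, hn₀, hnT, hpn, hncov⟩ := hm₀ m (le_trans (le_max_left _ _) hm) L hL
  -- `n ≤ |W|`: pick `n` distinct code words
  have hnW : n ≤ W.card := by
    rw [Real.rpow_natCast, ← Real.rpow_pow_comm hm0R] at hWcard
    exact_mod_cast hnT.trans hWcard
  let w : Fin n → Fin L → Fin r := fun i => (W.equivFin.symm (Fin.castLE hnW i) : W)
  have hwW : ∀ i, w i ∈ W := fun i => (W.equivFin.symm (Fin.castLE hnW i)).2
  have hwinj : Function.Injective w := fun i j hij =>
    Fin.castLE_injective hnW (W.equivFin.symm.injective (Subtype.ext hij))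
  -- the lifted family of `n` product blocks in `Fin L → ZMod m`
  obtain ⟨hW1, hX1⟩ := codeLift P Q hD W hS
  have hWA : ∀ i : Fin n, ∀ a ∈ Fintype.piFinset (fun t => P (w i t)),
      ∀ a' ∈ Fintype.piFinset (fun t => P (w i t)), ∀ b ∈ Fintype.piFinset (fun t => Q (w i t)),
      ∀ b' ∈ Fintype.piFinset (fun t => Q (w i t)), (a - a') + (b - b') = 0 → a = a' ∧ b = b' :=
    fun i => hW1 (w i) (hwW i)
  have hXA : ∀ i j k : Fin n, ∀ a ∈ Fintype.piFinset (fun t => P (w i t)),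
      ∀ a' ∈ Fintype.piFinset (fun t => P (w j t)), ∀ b ∈ Fintype.piFinset (fun t => Q (w j t)),
      ∀ b' ∈ Fintype.piFinset (fun t => Q (w k t)), (a - a') + (b - b') = 0 → i = k :=
    fun i j k a ha a' ha' b hb b' hb' h0 =>
      hwinj (hX1 (w i) (hwW i) (w j) (hwW j) (w k) (hwW k) a ha a' ha' b hb b' hb' h0)
  -- transfer into a prime cyclic host (route support CyclicReduction, transfer step)
  obtain ⟨p, hp, hpR, A', B', hcard, hW', hX'⟩ :=
    exists_prime_sdpp_of_addEquiv hWA hXA (m := fun _ : Fin L => m) (fun _ => hm1)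
      (AddEquiv.refl (Fin L → ZMod m))
  rw [Fin.prod_const] at hpR
  refine ⟨n, hn₀, p, hp, A', B', hW', hX', ?_, fun i => ?_⟩
  · -- `p ≤ 2·3^L·m^L ≤ n^(2+δ)`
    exact le_trans (by exact_mod_cast hpR) hpn
  · -- co-volume `|A' i||B' i| = ∏ₜ |P (w i t)||Q (w i t)| ≥ (m^(1-δ/16))^L ≥ n^(2-δ)`
    rw [(hcard i).1, (hcard i).2, Fintype.card_piFinset, Fintype.card_piFinset,
      ← Finset.prod_mul_distrib]
    refine hncov.trans ?_
    rw [← Fin.prod_const]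
    push_cast
    exact Finset.prod_le_prod (fun t _ => by positivity) fun t _ => by exact_mod_cast hcov (w i t)

end Summit.MatrixMultiplication.MatrixMultiplication.Theorems.PrimeTwoFamilies.CapacityLiftK21
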